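import Summits.HubbardSuperconductivity.HubbardSuperconductivity.Theorems.AnisotropyChordTransferFibre3N1Row
import Summits.HubbardSuperconductivity.HubbardSuperconductivity.Theorems.AnisotropyChordTransferFibre3GroundFormulas
import Summits.HubbardSuperconductivity.HubbardSuperconductivity.Theorems.AnisotropyChordTransferFibre3Lam2Small
import Summits.HubbardSuperconductivity.HubbardSuperconductivity.Theorems.AnisotropyChordTransferFibre3Lam2Bounds
import Summits.HubbardSuperconductivity.HubbardSuperconductivity.Theorems.AnisotropyChordTransferFibre3GreenZero

/-!
# Route `AnisotropyChord` / H0 rotor rung: PartN41-B §6 — the TAIL SLOPE and the `B`, `‖Π⁰‖²`, `A(x̂)` OUTER MAJORANTS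
(content versions with the repaired slope `κ̂′ = κ̂ + 2a c_s/V`)

Theory-1 g22's PartN41-B §6 (ported …Fibre3N1Row) majorises the one-loop tails off the block `|p|∞ ≤ M₂` termwise by
`|t(k)| ≤ κ̂ g(k)`, `κ̂ = 4c_s²G̃(0)ρ_{M₂}`.  The ported `kapHat` omits the pole term of `TtailBounds` (i): the claimed
`2a c_s/V ≤ κ̂` is equivalent to `a ≤ 2V/(2V−1)` and FAILS on the solution manifold when `ηG̃(0)(2V+1) < 1/4`
(`ν → 0⁺`, i.e. `Δ → 1⁻`, inside piece A).  This file proves the bounds with the repaired slope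
`κ̂′ := kapHat + 2·aPar·cS/V` (relative cost `≈ 1/(2V)` in the bulk of the regime):
★ `tail_slope_abs` — `|t(k)| ≤ κ̂′ g(k)` for `k ≠ 0` with `ε_T(k) ≥ ε_m = 1 − cos((M₂+1)θ)` (ground state, `0 ≤ Δ < 1`,
  `4(M₂+2) ≤ L`, `L ≥ 5`; from `ground_ttail` = TtailBounds (i),(iii) and `(2ε−λ)/(2ε−4λ)` decreasing in `ε`);
★ `pi2_outer_bound`, ★ `ax_outer_bound`, ★ `b_outer_bound` — the `‖Π⁰‖²`, `A(x̂)`, `B` outer majorants of `Pi2OuterBound`,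
  `AxOuterBound`, `BOuterBound` with `κ̂′` for `κ̂`, conditional on the typed §2/§6 targets `F2ClosedPlusTail L Δ`
  (`F₂ = c + t` off `0`) and `OuterEnergyFloor L M2` (taken as hypotheses; separate files).
Generic algebra: `abs_cube_diff_le`, `abs_sq_diff_mul_le`, `abs_sq_mul_diff_le`.
Prover seat `hubbard-h0-rotor-p1` g26 (route lead); helper for stmt-HubbardSuperconductivity-23918 (`--supports`, helper class).
WHAT THIS IS NOT: nothing here proves superconductivity in the Hubbard model; termwise majorants of ONE row of ONE conditional reduction.
Tree imports only; no new definitions; no sorry, no axioms.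
-/

set_option linter.dupNamespace false
set_option autoImplicit false

noncomputable section

open scoped BigOperators

namespace Summit.HubbardSuperconductivity.HubbardSuperconductivity.Theorems.AnisotropyChord.Transfer.Fibre3

variable (L : ℕ) [NeZero L]

namespace OuterMaj

/-! ## Generic algebra: closed part + tail, tail majorised -/

/-- `|(c+t)³ − c³| ≤ 3T c² + 3T²|c| + T³` when `|t| ≤ T`. [folklore] -/
theorem abs_cube_diff_le {c t T : ℝ} (ht : |t| ≤ T) :
    |(c + t) ^ 3 - c ^ 3| ≤ 3 * T * c ^ 2 + 3 * T ^ 2 * |c| + T ^ 3 := by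
  have hT : 0 ≤ T := (abs_nonneg t).trans ht
  have h1 : |t| * |t| ≤ T * T := mul_le_mul ht ht (abs_nonneg t) hT
  have e : (c + t) ^ 3 - c ^ 3 = t * (3 * c ^ 2) + t * t * (3 * c) + t * t * t := by ring
  rw [e]
  calc |t * (3 * c ^ 2) + t * t * (3 * c) + t * t * t|
      ≤ |t * (3 * c ^ 2)| + |t * t * (3 * c)| + |t * t * t| := abs_add_three _ _ _
    _ = |t| * (3 * c ^ 2) + |t| * |t| * (3 * |c|) + |t| * |t| * |t| := by
        simp only [abs_mul, abs_pow, abs_of_nonneg (show (0:ℝ) ≤ 3 by norm_num), sq_abs]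
    _ ≤ T * (3 * c ^ 2) + T * T * (3 * |c|) + T * T * T := by
        gcongr
    _ = 3 * T * c ^ 2 + 3 * T ^ 2 * |c| + T ^ 3 := by ring

/-- `|((c+t)² − c²)·w| ≤ 2|c|T + T²` when `|t| ≤ T`, `|w| ≤ 1`. [folklore] -/
theorem abs_sq_diff_mul_le {c t T w : ℝ} (ht : |t| ≤ T) (hw : |w| ≤ 1) :
    |((c + t) ^ 2 - c ^ 2) * w| ≤ 2 * |c| * T + T ^ 2 := by
  have hT : 0 ≤ T := (abs_nonneg t).trans ht
  have e : ((c + t) ^ 2 - c ^ 2) = t * (2 * c) + t * t := by ring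
  rw [abs_mul, e]
  have h2 : |t * (2 * c) + t * t| ≤ 2 * |c| * T + T ^ 2 := by
    calc |t * (2 * c) + t * t| ≤ |t * (2 * c)| + |t * t| := abs_add_le _ _
      _ = |t| * (2 * |c|) + |t| * |t| := by
          simp only [abs_mul, abs_of_nonneg (show (0:ℝ) ≤ 2 by norm_num)]
      _ ≤ T * (2 * |c|) + T * T := by gcongr
      _ = 2 * |c| * T + T ^ 2 := by ring
  have h0 : 0 ≤ |t * (2 * c) + t * t| := abs_nonneg _
  calc |t * (2 * c) + t * t| * |w| ≤ (2 * |c| * T + T ^ 2) * 1 :=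
        mul_le_mul h2 hw (abs_nonneg w) (h0.trans h2)
    _ = 2 * |c| * T + T ^ 2 := by ring

/-- `|(c+t)²(c′+t′) − c²c′| ≤ c²T′ + 2|c||c′|T + 2|c|TT′ + |c′|T² + T²T′` when `|t| ≤ T`, `|t′| ≤ T′`. [folklore] -/
theorem abs_sq_mul_diff_le {c c' t t' T T' : ℝ} (ht : |t| ≤ T) (ht' : |t'| ≤ T') :
    |(c + t) ^ 2 * (c' + t') - c ^ 2 * c'|
      ≤ c ^ 2 * T' + 2 * |c| * |c'| * T + 2 * |c| * T * T' + |c'| * T ^ 2 + T ^ 2 * T' := by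
  have hT : 0 ≤ T := (abs_nonneg t).trans ht
  have hT' : 0 ≤ T' := (abs_nonneg t').trans ht'
  have e : (c + t) ^ 2 * (c' + t') - c ^ 2 * c'
      = t' * c ^ 2 + t * (2 * c * c') + t * t' * (2 * c) + t * t * c' + t * t * t' := by ring
  rw [e]
  calc |t' * c ^ 2 + t * (2 * c * c') + t * t' * (2 * c) + t * t * c' + t * t * t'|
      ≤ |t' * c ^ 2 + t * (2 * c * c') + t * t' * (2 * c) + t * t * c'| + |t * t * t'| := abs_add_le _ _
    _ ≤ |t' * c ^ 2 + t * (2 * c * c') + t * t' * (2 * c)| + |t * t * c'| + |t * t * t'| := by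
        gcongr; exact abs_add_le _ _
    _ ≤ |t' * c ^ 2| + |t * (2 * c * c')| + |t * t' * (2 * c)| + |t * t * c'| + |t * t * t'| := by
        gcongr; exact abs_add_three _ _ _
    _ = |t'| * c ^ 2 + |t| * (2 * |c| * |c'|) + |t| * |t'| * (2 * |c|) + |t| * |t| * |c'| + |t| * |t| * |t'| := by
        simp only [abs_mul, abs_pow, sq_abs, abs_of_nonneg (show (0:ℝ) ≤ 2 by norm_num)]
    _ ≤ T' * c ^ 2 + T * (2 * |c| * |c'|) + T * T' * (2 * |c|) + T * T * |c'| + T * T * T' := by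
        gcongr
    _ = c ^ 2 * T' + 2 * |c| * |c'| * T + 2 * |c| * T * T' + |c'| * T ^ 2 + T ^ 2 * T' := by ring

/-! ## The tail slope off the block -/

omit [NeZero L] in
/-- the block energy floor dominates `ε₁`: `ε₁ ≤ 1 − cos((M₂+1)θ)` when `4(M₂+2) ≤ L`. [folklore] -/
theorem eps1_le_em (M2 : ℕ) (hM : 4 * (M2 + 2) ≤ L) :
    eps1 L ≤ 1 - Real.cos (2 * Real.pi * (M2 + 1) / L) := by
  unfold eps1
  have hLpos : (0 : ℝ) < L := by exact_mod_cast (show 0 < L by omega)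
  have hpi := Real.pi_pos
  have hθ : 0 ≤ 2 * Real.pi / L := by positivity
  have h1 : 2 * Real.pi / L ≤ 2 * Real.pi * (M2 + 1) / L := by
    rw [div_le_div_iff_of_pos_right hLpos]
    have : (0 : ℝ) ≤ M2 := Nat.cast_nonneg M2
    nlinarith
  have h2 : 2 * Real.pi * (M2 + 1) / L ≤ Real.pi := by
    rw [div_le_iff₀ hLpos]
    have : (4 * (M2 + 2) : ℝ) ≤ L := by exact_mod_cast hM
    nlinarith
  have := Real.cos_le_cos_of_nonneg_of_le_pi hθ h2 h1
  linarith

/-- `G̃(0) ≥ 0` below the free gap. [folklore] -/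
theorem Gzero_nonneg (hL : 2 ≤ L) {lam2 : ℝ} (hlam : lam2 < 2 * eps1 L) : 0 ≤ Gzero L lam2 := by
  unfold Gzero
  apply div_nonneg _ (by positivity)
  apply Finset.sum_nonneg
  intro p hp
  have hp0 : p ≠ 0 := (Finset.mem_erase.1 hp).1
  have := eps1_le_epsT L hL hp0
  have : 0 < 2 * epsT L p - lam2 := by linarith
  positivity

/-- ★ TAIL SLOPE off the block with the repaired slope `κ̂′ = κ̂ + 2a c_s/V`:
`|t(k)| ≤ (kapHat + 2·aPar·cS/V)·g(k)` for `k ≠ 0`, `ε_T(k) ≥ 1 − cos((M₂+1)θ)`. [folklore] -/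
theorem tail_slope_abs (hL : 5 ≤ L) {Δ : ℝ} (hΔ0 : 0 ≤ Δ) (hΔ1 : Δ < 1) {lam2 : ℝ} {f : Tor L → ℝ}
    (hf : IsGroundTwoMagnon L Δ lam2 f) (M2 : ℕ) (hM : 4 * (M2 + 2) ≤ L) (k : Tor L) (hk : k ≠ 0)
    (hfloor : 1 - Real.cos (2 * Real.pi * (M2 + 1) / L) ≤ epsT L k) :
    |tfun L Δ f k| ≤ (kapHat L Δ lam2 f M2 + 2 * aPar L Δ f * cS L Δ lam2 f / (L : ℝ) ^ 2) * gres L lam2 k := by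
  have hL2 : 2 ≤ L := by omega
  have hLpos : (0 : ℝ) < L := by exact_mod_cast (show 0 < L by omega)
  have h0 : 0 < lam2 := lam2_pos L (by omega) hΔ1 hf.1
  have h2l : 2 * lam2 < eps1 L := two_lam2_lt_eps1 L hL hΔ0 hf
  have hem := eps1_le_em L M2 hM
  have hε := eps1_le_epsT L hL2 hk
  obtain ⟨hlo, -, hup⟩ := ground_ttail L hL hΔ0 hΔ1 hf hk
  have hg : gres L lam2 k = 1 / (2 * epsT L k - lam2) := by unfold gres; rw [if_neg hk]
  have hfpos : 0 < f (K1 L) := hf.1.2.2.1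
  have hc : 0 ≤ cS L Δ lam2 f := by
    unfold cS; apply mul_nonneg hfpos.le; nlinarith
  have ha : 0 ≤ aPar L Δ f := by unfold aPar; exact mul_nonneg hΔ0 hfpos.le
  have hG : 0 ≤ Gzero L lam2 := Gzero_nonneg L hL2 (by linarith)
  have hden1 : 0 < 2 * epsT L k - lam2 := by linarith
  have hden2 : 0 < epsT L k - 2 * lam2 := by linarith
  have hden3 : 0 < 2 * (1 - Real.cos (2 * Real.pi * (M2 + 1) / L)) - 4 * lam2 := by linarith
  have hρ : rhoM L lam2 M2 = (2 * (1 - Real.cos (2 * Real.pi * (M2 + 1) / L)) - lam2)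
      / (2 * (1 - Real.cos (2 * Real.pi * (M2 + 1) / L)) - 4 * lam2) := rfl
  have hρ0 : 0 ≤ rhoM L lam2 M2 := by rw [hρ]; apply div_nonneg <;> linarith
  have hgpos : 0 < gres L lam2 k := by rw [hg]; positivity
  -- `1/(ε − 2λ) ≤ 2ρ g` since `(2ε−λ)/(2ε−4λ)` decreases in `ε` and `ε ≥ ε_m`
  have hkey : 1 / (epsT L k - 2 * lam2) ≤ 2 * rhoM L lam2 M2 * gres L lam2 k := by
    rw [hρ, hg]
    have e : 2 * ((2 * (1 - Real.cos (2 * Real.pi * (M2 + 1) / L)) - lam2)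
          / (2 * (1 - Real.cos (2 * Real.pi * (M2 + 1) / L)) - 4 * lam2)) * (1 / (2 * epsT L k - lam2))
        = (2 * (2 * (1 - Real.cos (2 * Real.pi * (M2 + 1) / L)) - lam2))
          / ((2 * (1 - Real.cos (2 * Real.pi * (M2 + 1) / L)) - 4 * lam2) * (2 * epsT L k - lam2)) := by
      field_simp
    rw [e, div_le_div_iff₀ hden2 (by positivity)]
    nlinarith [mul_nonneg h0.le (sub_nonneg.2 hfloor)]
  have hup' : tfun L Δ f k ≤ kapHat L Δ lam2 f M2 * gres L lam2 k := by
    calc tfun L Δ f k ≤ 2 * cS L Δ lam2 f ^ 2 * Gzero L lam2 / (epsT L k - 2 * lam2) := hup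
      _ = 2 * cS L Δ lam2 f ^ 2 * Gzero L lam2 * (1 / (epsT L k - 2 * lam2)) := by ring
      _ ≤ 2 * cS L Δ lam2 f ^ 2 * Gzero L lam2 * (2 * rhoM L lam2 M2 * gres L lam2 k) :=
          mul_le_mul_of_nonneg_left hkey (by positivity)
      _ = kapHat L Δ lam2 f M2 * gres L lam2 k := by unfold kapHat; ring
  have hlo' : -(2 * aPar L Δ f * cS L Δ lam2 f / (L : ℝ) ^ 2) * gres L lam2 k ≤ tfun L Δ f k := by
    have e : -(2 * Δ * f (K1 L) * cS L Δ lam2 f / (2 * epsT L k - lam2)) / (L : ℝ) ^ 2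
        = -(2 * aPar L Δ f * cS L Δ lam2 f / (L : ℝ) ^ 2) * gres L lam2 k := by
      unfold aPar; rw [hg]; field_simp
    rw [← e]; exact hlo
  have hkg : 0 ≤ kapHat L Δ lam2 f M2 * gres L lam2 k := by
    unfold kapHat; positivity
  have hag : 0 ≤ 2 * aPar L Δ f * cS L Δ lam2 f / (L : ℝ) ^ 2 * gres L lam2 k := by positivity
  rw [abs_le]
  constructor
  · nlinarith
  · nlinarith

/-! ## The three real outer majorants with `κ̂′` -/

/-- `|c(k)| = 2c_s g(k) + d` and `c(k)² = (2c_s g(k) + d)²` in the regime (`c_s, g, d ≥ 0`). [folklore] -/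
theorem abs_cK_eq (hL : 5 ≤ L) {Δ : ℝ} (hΔ0 : 0 ≤ Δ) (hΔ1 : Δ < 1) {lam2 : ℝ} {f : Tor L → ℝ}
    (hf : IsGroundTwoMagnon L Δ lam2 f) (k : Tor L) :
    |cK L Δ lam2 f k| = 2 * cS L Δ lam2 f * gres L lam2 k + dPar L Δ f := by
  have hL2 : 2 ≤ L := by omega
  have h0 : 0 < lam2 := lam2_pos L (by omega) hΔ1 hf.1
  have h2l : 2 * lam2 < eps1 L := two_lam2_lt_eps1 L hL hΔ0 hf
  have hfpos : 0 < f (K1 L) := hf.1.2.2.1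
  have hc : 0 ≤ cS L Δ lam2 f := by
    unfold cS; apply mul_nonneg hfpos.le; nlinarith
  have hg : 0 ≤ gres L lam2 k := gres_nonneg_of_lt L hL2 (by linarith) k
  have hd : 0 ≤ dPar L Δ f := by unfold dPar; positivity
  unfold cK
  rw [abs_neg, abs_of_nonneg (by positivity)]

/-- ★ `‖Π⁰‖²` OUTER MAJORANT (repaired slope): with `κ̂′ = kapHat + 2a c_s/V`, `|c| = 2c_s g + d`,
`|Σ_{outer1} (F₂³ − c³)| ≤ Σ_{outer1} [3κ̂′ |c|² g + 3κ̂′² |c| g² + κ̂′³ g³]`. [folklore] -/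
theorem pi2_outer_bound (hL : 5 ≤ L) {Δ : ℝ} (hΔ0 : 0 ≤ Δ) (hΔ1 : Δ < 1) {lam2 : ℝ} {f : Tor L → ℝ}
    (hf : IsGroundTwoMagnon L Δ lam2 f) (M2 : ℕ) (hM : 4 * (M2 + 2) ≤ L)
    (hF2 : F2ClosedPlusTail L Δ) (hfl : OuterEnergyFloor L M2) :
    |∑ k ∈ outer1 L M2, (F2 L f k ^ 3 - cK L Δ lam2 f k ^ 3)|
      ≤ ∑ k ∈ outer1 L M2,
          (3 * (kapHat L Δ lam2 f M2 + 2 * aPar L Δ f * cS L Δ lam2 f / (L : ℝ) ^ 2)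
              * (2 * cS L Δ lam2 f * gres L lam2 k + dPar L Δ f) ^ 2 * gres L lam2 k
            + 3 * (kapHat L Δ lam2 f M2 + 2 * aPar L Δ f * cS L Δ lam2 f / (L : ℝ) ^ 2) ^ 2
              * (2 * cS L Δ lam2 f * gres L lam2 k + dPar L Δ f) * gres L lam2 k ^ 2
            + (kapHat L Δ lam2 f M2 + 2 * aPar L Δ f * cS L Δ lam2 f / (L : ℝ) ^ 2) ^ 3 * gres L lam2 k ^ 3) := by
  have h0 : 0 < lam2 := lam2_pos L (by omega) hΔ1 hf.1
  have hdec := (hF2 lam2 f hf h0).2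
  have hfl' := (hfl hM).2
  refine (Finset.abs_sum_le_sum_abs _ _).trans (Finset.sum_le_sum fun k hk => ?_)
  have hk0 : k ≠ 0 := by
    unfold outer1 at hk
    exact (Finset.mem_erase.1 (Finset.mem_filter.1 hk).1).1
  have ht := tail_slope_abs L hL hΔ0 hΔ1 hf M2 hM k hk0 (hfl' k hk)
  rw [hdec k hk0]
  have hc := abs_cK_eq L hL hΔ0 hΔ1 hf k
  have := abs_cube_diff_le (c := cK L Δ lam2 f k) ht
  rw [hc] at this
  have hsq : cK L Δ lam2 f k ^ 2 = (2 * cS L Δ lam2 f * gres L lam2 k + dPar L Δ f) ^ 2 := by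
    rw [← hc, sq_abs]
  rw [hsq] at this
  refine this.trans (le_of_eq ?_)
  ring

/-- ★ `A(x̂)` OUTER MAJORANT (repaired slope): `|Σ_{outer1} (F₂² − c²) cos kₓ| ≤ Σ_{outer1} [2κ̂′|c| g + κ̂′² g²]`. [folklore] -/
theorem ax_outer_bound (hL : 5 ≤ L) {Δ : ℝ} (hΔ0 : 0 ≤ Δ) (hΔ1 : Δ < 1) {lam2 : ℝ} {f : Tor L → ℝ}
    (hf : IsGroundTwoMagnon L Δ lam2 f) (M2 : ℕ) (hM : 4 * (M2 + 2) ≤ L)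
    (hF2 : F2ClosedPlusTail L Δ) (hfl : OuterEnergyFloor L M2) :
    |∑ k ∈ outer1 L M2, (F2 L f k ^ 2 - cK L Δ lam2 f k ^ 2) * Real.cos (2 * Real.pi * k.1.val / L)|
      ≤ ∑ k ∈ outer1 L M2,
          (2 * (kapHat L Δ lam2 f M2 + 2 * aPar L Δ f * cS L Δ lam2 f / (L : ℝ) ^ 2)
              * (2 * cS L Δ lam2 f * gres L lam2 k + dPar L Δ f) * gres L lam2 k
            + (kapHat L Δ lam2 f M2 + 2 * aPar L Δ f * cS L Δ lam2 f / (L : ℝ) ^ 2) ^ 2 * gres L lam2 k ^ 2) := by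
  have h0 : 0 < lam2 := lam2_pos L (by omega) hΔ1 hf.1
  have hdec := (hF2 lam2 f hf h0).2
  have hfl' := (hfl hM).2
  refine (Finset.abs_sum_le_sum_abs _ _).trans (Finset.sum_le_sum fun k hk => ?_)
  have hk0 : k ≠ 0 := by
    unfold outer1 at hk
    exact (Finset.mem_erase.1 (Finset.mem_filter.1 hk).1).1
  have ht := tail_slope_abs L hL hΔ0 hΔ1 hf M2 hM k hk0 (hfl' k hk)
  rw [hdec k hk0]
  have hc := abs_cK_eq L hL hΔ0 hΔ1 hf k
  have := abs_sq_diff_mul_le (c := cK L Δ lam2 f k) ht (Real.abs_cos_le_one (2 * Real.pi * k.1.val / L))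
  rw [hc] at this
  refine this.trans (le_of_eq ?_)
  ring

/-- ★ `B` OUTER MAJORANT (repaired slope): with `g′ = g(k + K₁)`, `|c′| = 2c_s g′ + d`,
`|Σ_{outerP} (F₂²F₂′ − c²c′)| ≤ Σ_{outerP} [κ̂′(2|c||c′|g + |c|²g′) + κ̂′²(g²|c′| + 2|c|gg′) + κ̂′³g²g′]`. [folklore] -/
theorem b_outer_bound (hL : 5 ≤ L) {Δ : ℝ} (hΔ0 : 0 ≤ Δ) (hΔ1 : Δ < 1) {lam2 : ℝ} {f : Tor L → ℝ}
    (hf : IsGroundTwoMagnon L Δ lam2 f) (M2 : ℕ) (hM : 4 * (M2 + 2) ≤ L)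
    (hF2 : F2ClosedPlusTail L Δ) (hfl : OuterEnergyFloor L M2) :
    |∑ k ∈ outerP L M2, (F2 L f k ^ 2 * F2 L f (k + K1 L) - cK L Δ lam2 f k ^ 2 * cK L Δ lam2 f (k + K1 L))|
      ≤ ∑ k ∈ outerP L M2,
          ((kapHat L Δ lam2 f M2 + 2 * aPar L Δ f * cS L Δ lam2 f / (L : ℝ) ^ 2)
              * (2 * (2 * cS L Δ lam2 f * gres L lam2 k + dPar L Δ f)
                    * (2 * cS L Δ lam2 f * gres L lam2 (k + K1 L) + dPar L Δ f) * gres L lam2 k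
                  + (2 * cS L Δ lam2 f * gres L lam2 k + dPar L Δ f) ^ 2 * gres L lam2 (k + K1 L))
            + (kapHat L Δ lam2 f M2 + 2 * aPar L Δ f * cS L Δ lam2 f / (L : ℝ) ^ 2) ^ 2
              * (gres L lam2 k ^ 2 * (2 * cS L Δ lam2 f * gres L lam2 (k + K1 L) + dPar L Δ f)
                  + 2 * (2 * cS L Δ lam2 f * gres L lam2 k + dPar L Δ f) * gres L lam2 k * gres L lam2 (k + K1 L))
            + (kapHat L Δ lam2 f M2 + 2 * aPar L Δ f * cS L Δ lam2 f / (L : ℝ) ^ 2) ^ 3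
              * gres L lam2 k ^ 2 * gres L lam2 (k + K1 L)) := by
  have h0 : 0 < lam2 := lam2_pos L (by omega) hΔ1 hf.1
  have hdec := (hF2 lam2 f hf h0).2
  have hfl' := (hfl hM).1
  refine (Finset.abs_sum_le_sum_abs _ _).trans (Finset.sum_le_sum fun k hk => ?_)
  have hkT : k ∈ torPrime L := by
    unfold outerP at hk
    exact (Finset.mem_filter.1 hk).1
  have hk0 : k ≠ 0 ∧ k + K1 L ≠ 0 := by
    unfold torPrime at hkT
    exact (Finset.mem_filter.1 hkT).2
  obtain ⟨hflk, hflk'⟩ := hfl' k hk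
  have ht := tail_slope_abs L hL hΔ0 hΔ1 hf M2 hM k hk0.1 hflk
  have ht' := tail_slope_abs L hL hΔ0 hΔ1 hf M2 hM (k + K1 L) hk0.2 hflk'
  rw [hdec k hk0.1, hdec (k + K1 L) hk0.2]
  have hc := abs_cK_eq L hL hΔ0 hΔ1 hf k
  have hc' := abs_cK_eq L hL hΔ0 hΔ1 hf (k + K1 L)
  have := abs_sq_mul_diff_le (c := cK L Δ lam2 f k) (c' := cK L Δ lam2 f (k + K1 L)) ht ht'
  rw [hc, hc'] at this
  have hsq : cK L Δ lam2 f k ^ 2 = (2 * cS L Δ lam2 f * gres L lam2 k + dPar L Δ f) ^ 2 := by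
    rw [← hc, sq_abs]
  refine this.trans (le_of_eq ?_)
  rw [hsq]
  ring

end OuterMaj

end Summit.HubbardSuperconductivity.HubbardSuperconductivity.Theorems.AnisotropyChord.Transfer.Fibre3

end
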